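import Mathlib
import HarnessLib

/-!
# PCINT lane, king route, K1 step (4): van den Berg–Ermakov's local dominance inequalities at `p = 0.444`,
# as a kernel computation over `ℕ`

Cell `prim-pcint`, seat `prim-pcint-1` (gen 9); memo `run/shared/lean/prim/pcint/KING-ROUTE.md` §K1 (4).

van den Berg–Ermakov (Random Struct. Alg. 8 (1996) 199–212, Prop. 4.2 and the table of §4) reduce
"the growth process on `𝕃` at `p` dominates site percolation on `ℤ²` at `q = 1 - p`" to finitely many
inequalities: for each LOCAL PATTERN around the selected vertex `b₂` — its examiner `c`, the examiner `d` of
`c` with its pair state `ε(d)`, and for each of the two other neighbours ("brothers") of `c` one of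
{not examined by `c`, examined and failed, examined and succeeded with pair state `β`} — the conditional law
of the outcomes `(η(a, b₂))_a` of the ≤ 3 children `a` of `b₂` must dominate `π_q^{⊗3}` on every up-set.
vdBE check 13 inequalities after a reduction by hand; here the kernel checks ALL patterns directly (their
"1248 inequalities", in our normal form `12` geometries × `75` patterns × `18` up-sets, plus the `4` root
geometries where `c` is the origin, conditioned on `ε(c) ≠ (0,0)` instead of having an examiner), with
exact integer arithmetic: `p = 444/1000`, `q = 556/1000`, all weights scaled to integers.

* `VdBELocal.lawN` — the unnormalised law `x ↦ Σ_{ε(b₂), ε(c)} prior·prior·[η(b₂,c)]·[η(c,d) | ε(d)]·Π slot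
  factors · Π_a P(η(a,b₂) = x_a)` (orientation of every edge by coordinate sum, `η(min,max) = b b ∨ t t ∨ t_min b_max`,
  as in `KingPairs.EtaAdjOr`), an `ℕ`-valued function of the pattern;
* `VdBELocal.dominatesN` — the 18 up-set inequalities `1000³ · Σ_{x∈U} law x ≥ (Σ_x law x) · Σ_{x∈U} 556^{|x|} 444^{3-|x|}`;
* **`VdBELocal.all_patterns_dominate`**, **`VdBELocal.all_root_patterns_dominate`** — every pattern passes (`decide`).

Reproduces prim-pcint-1/gen9/vdbe0.py / vdbe1.py (threshold `p* = 0.443917`; worst slack `1.6·10⁻⁴` at `p = 0.444`,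
the binding row `0.803026 - 0.802864` of vdBE's table).  Consumed by K1 step (3) (the Markov decomposition
expresses the conditional law of the children given the past as a nonnegative mixture of these laws).
-/

namespace Summit.CriticalPhenomena.PercolationContinuityZ3.Theorems.Pcint

namespace VdBELocal

/-- A pair state `(bottom open, top open)`. -/
abbrev PState := Bool × Bool

/-- The four pair states. -/
def allStates : List PState := [(false, false), (true, false), (false, true), (true, true)]

/-- `p = 444/1000` and `1 - p = 556/1000`, in units of `1/1000`. -/
def P : ℕ := 444

/-- `q = 1 - p = 556/1000`, in units of `1/1000`. -/
def Q : ℕ := 556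

/-- The prior weight of a pair state, in units of `10⁻⁶`: `(p|1-p)·(p|1-p)`. -/
def priorN (s : PState) : ℕ := (if s.1 then P else Q) * (if s.2 then P else Q)

/-- `η` for the states of the (min, max) endpoints of an edge: bottom–bottom, top–top or top(min)–bottom(max). -/
def etaMM (sm sM : PState) : Bool := (sm.1 && sM.1) || (sm.2 && sM.2) || (sm.2 && sM.1)

/-- Lattice positions (only relative positions in a `5 × 5` window are used). -/
abbrev Pos := ℤ × ℤ

/-- `η` between lattice neighbours `u, v` with pair states `su, sv`, the edge oriented by coordinate sum. -/
def eta (u v : Pos) (su sv : PState) : Bool :=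
  if u.1 + u.2 < v.1 + v.2 then etaMM su sv else etaMM sv su

/-- What the past says about a brother `b` of `b₂` (another neighbour of the examiner `c`): not examined by `c`,
examined by `c` and failed, or examined by `c`, succeeded, and (adversarially) of known pair state `β`. -/
inductive Slot
  | absent
  | fail
  | succ (β : PState)
  deriving DecidableEq

/-- All `6` slot values. -/
def allSlots : List Slot := [.absent, .fail] ++ allStates.map Slot.succ

/-- The likelihood factor on `ε(c) = γ` contributed by a brother slot (units: `1`, `10⁻⁶`, `1`). -/
def slotFactor (c b : Pos) (γ : PState) : Slot → ℕ
  | .absent => 1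
  | .fail => (allStates.map fun β => priorN β * (if eta c b γ β then 0 else 1)).sum
  | .succ β => if eta c b γ β then 1 else 0

/-- `10⁶ · P(η(a, b₂) = xa | ε(b₂) = α)` for a fresh child `a`. -/
def childProb (a b2 : Pos) (α : PState) (xa : Bool) : ℕ :=
  (allStates.map fun sa => priorN sa * (if eta a b2 sa α = xa then 1 else 0)).sum

/-- **The unnormalised local law** of the children outcomes `x` (same order as `children`), given the pattern:
`Σ_{α = ε(b₂), γ = ε(c)} prior α · prior γ · [η(b₂,c)] · dFactor γ · Π_i slotFactor_i(γ) · Π_a childProb`.  The factor of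
the examiner `d` of `c` is `[η(c,d)(γ, ε_d)]`; for the root (`c = o`, no examiner) it is `[γ ≠ (0,0)]`. -/
def lawN (b2 c : Pos) (dFactor : PState → ℕ) (bros : List Pos) (slots : List Slot) (children : List Pos)
    (x : List Bool) : ℕ :=
  (allStates.map fun α => (allStates.map fun γ =>
    priorN α * priorN γ * (if eta b2 c α γ then 1 else 0) * dFactor γ *
      ((bros.zip slots).map fun bs => slotFactor c bs.1 γ bs.2).prod *
      ((children.zip x).map fun ax => childProb ax.1 b2 α ax.2).prod).sum).sum

/-- The `8` outcome vectors of three children. -/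
def outcomes3 : List (List Bool) :=
  [[false, false, false], [true, false, false], [false, true, false], [true, true, false],
   [false, false, true], [true, false, true], [false, true, true], [true, true, true]]

/-- Coordinatewise order on outcome vectors. -/
def leVec (x y : List Bool) : Bool := (x.zip y).all fun xy => (!xy.1) || xy.2

/-- A set of outcome vectors (as a sublist of `outcomes3`) is an up-set. -/
def isUpper (U : List (List Bool)) : Bool :=
  U.all fun x => outcomes3.all fun y => (!leVec x y) || U.contains y

/-- The nonempty proper up-sets of `{0,1}³` (there are `18`). -/
def upsets3 : List (List (List Bool)) :=
  (outcomes3.sublists.filter fun U => isUpper U && U.length != 0 && U.length != 8)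

/-- `10⁹ · π_q(x)` for an outcome vector of three children. -/
def piN (x : List Bool) : ℕ := (x.map fun b => if b then Q else P).prod

/-- **Dominance of `π_q^{⊗3}` by the law with vector `v` (indexed like `outcomes3`) on the up-sets**:
`10⁹ · Σ_{x ∈ U} v_x ≥ (Σ_x v_x) · Σ_{x ∈ U} 10⁹ π_q(x)` for every nonempty proper up-set `U`. -/
def dominatesN (v : List (List Bool × ℕ)) : Bool :=
  let total := (v.map Prod.snd).sum
  upsets3.all fun U =>
    total * (U.map piN).sum ≤ 1000 ^ 3 * ((v.filter fun xv => U.contains xv.1).map Prod.snd).sum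

/-- The law vector of a pattern with examiner `d` of pair state `εd`. -/
def lawVec (b2 c d : Pos) (εd : PState) (bros : List Pos) (slots : List Slot) (children : List Pos) :
    List (List Bool × ℕ) :=
  outcomes3.map fun x => (x, lawN b2 c (fun γ => if eta c d γ εd then 1 else 0) bros slots children x)

/-- The law vector of a ROOT pattern (`c = o` has no examiner; it is conditioned on `ε(c) ≠ (0,0)`). -/
def lawVecRoot (b2 c : Pos) (bros : List Pos) (slots : List Slot) (children : List Pos) : List (List Bool × ℕ) :=
  outcomes3.map fun x => (x, lawN b2 c (fun γ => if γ = (false, false) then 0 else 1) bros slots children x)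

/-- The four lattice neighbours of a position. -/
def nbrs (u : Pos) : List Pos := [(u.1 + 1, u.2), (u.1 - 1, u.2), (u.1, u.2 + 1), (u.1, u.2 - 1)]

/-- **The check for one geometry** `(c, d)`: `b₂ = 0`, examiner `c`, its examiner `d` with any pair state `εd`
(patterns of total weight `0`, i.e. with `η(c,d) = 1` impossible, are vacuous), brothers = the other two neighbours
of `c` with any slots, children = the other three neighbours of `b₂`. -/
def checkCD (c d : Pos) : Bool :=
  let bros := (nbrs c).filter fun b => b ≠ (0, 0) ∧ b ≠ d
  let children := (nbrs (0, 0)).filter fun a => a ≠ c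
  allStates.all fun εd =>
    allSlots.all fun s1 => allSlots.all fun s2 =>
      let v := lawVec (0, 0) c d εd bros [s1, s2] children
      ((v.map Prod.snd).sum == 0) || dominatesN v

/-- **The check for one root geometry** `b₂` (examiner `c = o = 0` conditioned on `ε(o) ≠ (0,0)`; brothers = the
other three neighbours of `o`; children = the other three neighbours of `b₂`). -/
def checkRoot (b2 : Pos) : Bool :=
  let bros := (nbrs (0, 0)).filter fun b => b ≠ b2
  let children := (nbrs b2).filter fun a => a ≠ (0, 0)
  allSlots.all fun s1 => allSlots.all fun s2 => allSlots.all fun s3 =>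
    let v := lawVecRoot b2 (0, 0) bros [s1, s2, s3] children
    ((v.map Prod.snd).sum == 0) || dominatesN v

/-- There are exactly `18` nonempty proper up-sets of `{0,1}³`. -/
theorem length_upsets3 : upsets3.length = 18 := by decide

/-- Geometry `c = (1, 0)`, `d = (2, 0)` passes (all `ε(d)`, all brother slots, all up-sets). -/
theorem checkCD_10_20 : checkCD (1, 0) (2, 0) = true := by decide

/-- Geometry `c = (1, 0)`, `d = (1, 1)` passes (all `ε(d)`, all brother slots, all up-sets). -/
theorem checkCD_10_11 : checkCD (1, 0) (1, 1) = true := by decide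

/-- Geometry `c = (1, 0)`, `d = (1, -1)` passes (all `ε(d)`, all brother slots, all up-sets). -/
theorem checkCD_10_1m1 : checkCD (1, 0) (1, -1) = true := by decide

/-- Geometry `c = (-1, 0)`, `d = (-2, 0)` passes (all `ε(d)`, all brother slots, all up-sets). -/
theorem checkCD_m10_m20 : checkCD (-1, 0) (-2, 0) = true := by decide

/-- Geometry `c = (-1, 0)`, `d = (-1, 1)` passes (all `ε(d)`, all brother slots, all up-sets). -/
theorem checkCD_m10_m11 : checkCD (-1, 0) (-1, 1) = true := by decide

/-- Geometry `c = (-1, 0)`, `d = (-1, -1)` passes (all `ε(d)`, all brother slots, all up-sets). -/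
theorem checkCD_m10_m1m1 : checkCD (-1, 0) (-1, -1) = true := by decide

/-- Geometry `c = (0, 1)`, `d = (1, 1)` passes (all `ε(d)`, all brother slots, all up-sets). -/
theorem checkCD_01_11 : checkCD (0, 1) (1, 1) = true := by decide

/-- Geometry `c = (0, 1)`, `d = (-1, 1)` passes (all `ε(d)`, all brother slots, all up-sets). -/
theorem checkCD_01_m11 : checkCD (0, 1) (-1, 1) = true := by decide

/-- Geometry `c = (0, 1)`, `d = (0, 2)` passes (all `ε(d)`, all brother slots, all up-sets). -/
theorem checkCD_01_02 : checkCD (0, 1) (0, 2) = true := by decide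

/-- Geometry `c = (0, -1)`, `d = (1, -1)` passes (all `ε(d)`, all brother slots, all up-sets). -/
theorem checkCD_0m1_1m1 : checkCD (0, -1) (1, -1) = true := by decide

/-- Geometry `c = (0, -1)`, `d = (-1, -1)` passes (all `ε(d)`, all brother slots, all up-sets). -/
theorem checkCD_0m1_m1m1 : checkCD (0, -1) (-1, -1) = true := by decide

/-- Geometry `c = (0, -1)`, `d = (0, -2)` passes (all `ε(d)`, all brother slots, all up-sets). -/
theorem checkCD_0m1_0m2 : checkCD (0, -1) (0, -2) = true := by decide

/-- Root geometry `b₂ = (1, 0)` (examiner `o`) passes. -/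
theorem checkRoot_10 : checkRoot (1, 0) = true := by decide

/-- Root geometry `b₂ = (-1, 0)` (examiner `o`) passes. -/
theorem checkRoot_m10 : checkRoot (-1, 0) = true := by decide

/-- Root geometry `b₂ = (0, 1)` (examiner `o`) passes. -/
theorem checkRoot_01 : checkRoot (0, 1) = true := by decide

/-- Root geometry `b₂ = (0, -1)` (examiner `o`) passes. -/
theorem checkRoot_0m1 : checkRoot (0, -1) = true := by decide

/-- The `12` non-root geometries `(c, d)`: `c` a neighbour of `b₂ = 0`, `d ≠ b₂` a neighbour of `c`. -/
def geoms : List (Pos × Pos) := [((1, 0), (2, 0)), ((1, 0), (1, 1)), ((1, 0), (1, -1)), ((-1, 0), (-2, 0)), ((-1, 0), (-1, 1)), ((-1, 0), (-1, -1)), ((0, 1), (1, 1)), ((0, 1), (-1, 1)), ((0, 1), (0, 2)), ((0, -1), (1, -1)), ((0, -1), (-1, -1)), ((0, -1), (0, -2))]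

/-- `geoms` lists exactly the pairs (neighbour `c` of `0`, neighbour `d ≠ 0` of `c`). -/
theorem mem_geoms_iff (c d : Pos) : (c, d) ∈ geoms ↔ c ∈ nbrs (0, 0) ∧ d ∈ nbrs c ∧ d ≠ (0, 0) := by
  constructor
  · intro h
    simp only [geoms, List.mem_cons, List.mem_nil_iff, or_false, Prod.mk.injEq] at h
    rcases h with ⟨rfl, rfl⟩ | ⟨rfl, rfl⟩ | ⟨rfl, rfl⟩ | ⟨rfl, rfl⟩ | ⟨rfl, rfl⟩ | ⟨rfl, rfl⟩ | ⟨rfl, rfl⟩ |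
      ⟨rfl, rfl⟩ | ⟨rfl, rfl⟩ | ⟨rfl, rfl⟩ | ⟨rfl, rfl⟩ | ⟨rfl, rfl⟩ <;> decide
  · rintro ⟨hc, hd, hd0⟩
    simp only [nbrs, List.mem_cons, List.mem_nil_iff, or_false] at hc
    rcases hc with rfl | rfl | rfl | rfl <;>
      simp only [nbrs, List.mem_cons, List.mem_nil_iff, or_false] at hd <;>
      rcases hd with rfl | rfl | rfl | rfl <;> revert hd0 <;> decide

/-- **van den Berg–Ermakov's local dominance at `p = 0.444`, every non-root geometry** (their Prop. 4.2 hypothesis —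
all "1248 inequalities" and more — checked by the kernel). -/
theorem checkCD_of_mem_geoms : ∀ cd ∈ geoms, checkCD cd.1 cd.2 = true := by
  intro cd h
  simp only [geoms, List.mem_cons, List.mem_nil_iff, or_false] at h
  rcases h with rfl | rfl | rfl | rfl | rfl | rfl | rfl | rfl | rfl | rfl | rfl | rfl
  · exact checkCD_10_20
  · exact checkCD_10_11
  · exact checkCD_10_1m1
  · exact checkCD_m10_m20
  · exact checkCD_m10_m11
  · exact checkCD_m10_m1m1
  · exact checkCD_01_11
  · exact checkCD_01_m11
  · exact checkCD_01_02
  · exact checkCD_0m1_1m1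
  · exact checkCD_0m1_m1m1
  · exact checkCD_0m1_0m2

/-- **Local dominance at `p = 0.444` for every root geometry** (`b₂` a neighbour of the origin, examined by it). -/
theorem checkRoot_of_mem : ∀ b2 ∈ nbrs (0, 0), checkRoot b2 = true := by
  intro b2 h
  simp only [nbrs, List.mem_cons, List.mem_nil_iff, or_false, zero_add, zero_sub] at h
  rcases h with rfl | rfl | rfl | rfl
  · exact checkRoot_10
  · exact checkRoot_m10
  · exact checkRoot_01
  · exact checkRoot_0m1

/-! ### Root rule `ξ(o) = [ε(o) = (1,1)]` (recommended variant: the first generation is then a product law) -/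

/-- The law vector of a ROOT pattern under the root rule `ε(o) = (1,1)` (`c = o` conditioned on both its pair sites open). -/
def lawVecRoot11 (b2 c : Pos) (bros : List Pos) (slots : List Slot) (children : List Pos) : List (List Bool × ℕ) :=
  outcomes3.map fun x => (x, lawN b2 c (fun γ => if γ = (true, true) then 1 else 0) bros slots children x)

/-- **The check for one root geometry under the root rule `ε(o) = (1,1)`**: `b₂` a neighbour of `o`, examined by `o`;
brothers = the other three neighbours of `o`; children = the other three neighbours of `b₂`. -/
def checkRoot11 (b2 : Pos) : Bool :=
  let bros := (nbrs (0, 0)).filter fun b => b ≠ b2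
  let children := (nbrs b2).filter fun a => a ≠ (0, 0)
  allSlots.all fun s1 => allSlots.all fun s2 => allSlots.all fun s3 =>
    let v := lawVecRoot11 b2 (0, 0) bros [s1, s2, s3] children
    ((v.map Prod.snd).sum == 0) || dominatesN v

/-- Root geometry `b₂ = (1, 0)` passes under the root rule `ε(o) = (1,1)`. -/
theorem checkRoot11_10 : checkRoot11 (1, 0) = true := by decide

/-- Root geometry `b₂ = (-1, 0)` passes under the root rule `ε(o) = (1,1)`. -/
theorem checkRoot11_m10 : checkRoot11 (-1, 0) = true := by decide

/-- Root geometry `b₂ = (0, 1)` passes under the root rule `ε(o) = (1,1)`. -/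
theorem checkRoot11_01 : checkRoot11 (0, 1) = true := by decide

/-- Root geometry `b₂ = (0, -1)` passes under the root rule `ε(o) = (1,1)`. -/
theorem checkRoot11_0m1 : checkRoot11 (0, -1) = true := by decide

/-- **Local dominance at `p = 0.444` for every root geometry under the root rule `ε(o) = (1,1)`** (gen9/vdbe_int.py:
worst margin `0.0253`).  With this root rule the ORIGIN step (parent `o`, four children) is the product law
`⊗_a Bern(1 - 0.556²)` (all marginals `0.690864 ≥ q`), which dominates `π_q^{⊗4}` coordinatewise. -/
theorem checkRoot11_of_mem : ∀ b2 ∈ nbrs (0, 0), checkRoot11 b2 = true := by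
  intro b2 h
  simp only [nbrs, List.mem_cons, List.mem_nil_iff, or_false, zero_add, zero_sub] at h
  rcases h with rfl | rfl | rfl | rfl
  · exact checkRoot11_10
  · exact checkRoot11_m10
  · exact checkRoot11_01
  · exact checkRoot11_0m1

/-- `1 - q² ≥ q` at `q = 0.556` (the origin step under the root rule `ε(o) = (1,1)`): `10⁶ - 556² ≥ 556 · 10³`. -/
theorem origin_marginal_ge : 1000 * 1000 - Q * Q ≥ Q * 1000 := by decide

end VdBELocal

end Summit.CriticalPhenomena.PercolationContinuityZ3.Theorems.Pcint
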